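import Literature.NumberTheory.GaloisRepresentations.BrauerCyclicLayer
import Literature.NumberTheory.GaloisRepresentations.BrauerCocycleTransfer
import Literature.NumberTheory.GaloisRepresentations.BrauerTower
import Literature.NumberTheory.GaloisRepresentations.GaloisSubgroups
import Literature.NumberTheory.GaloisRepresentations.GaloisCohomologyInfResProofs
import Mathlib.GroupTheory.Sylow
import Mathlib.GroupTheory.PGroup
import HarnessLib

/-!
# The Hasse principle for `H²(K, K̄ˣ)` (Albert–Brauer–Hasse–Noether)

Topic `NumberTheory/GaloisRepresentations` (Galois cohomology of number fields); namespace
`Literature.NumberTheory.GaloisRepresentations`.  Proof file: theorems only (no definition, no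
instance, no named fact; D-0026).

**Theorem** (`twoCocycle_cob_of_locallyTrivial`).  Let `K` be a number field and
`e : Γ_K × Γ_K → K̄ˣ` a locally constant `2`-cocycle (`e(σ,τ) e(στ,υ) = σe(τ,υ) e(σ,τυ)`) which
becomes a coboundary over every completion: for every finite place `v` (resp. infinite place `w`)
the pull-back `ι ∘ e ∘ (res × res)` to `Γ_{K_v}` (resp. `Γ_{K_w}`) along the tree's restriction
`absGaloisRestrict` and embedding `absClosureEmbedding : K̄ → K̄_v` is the coboundary of a locally
constant cochain.  Then `e` is the coboundary of a locally constant cochain `Γ_K → K̄ˣ`.  This is the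
injectivity of `Br(K) = H²(Γ_K, K̄ˣ) → ⊕_v Br(K_v)` (Albert–Brauer–Hasse–Noether; Cassels–Fröhlich
VII §9.6 with §10; NSW (8.1.17)), in the explicit-cocycle language of `BrauerGroupCocycles.lean`.

**Proof** (the classical reduction to cyclic layers, `twoCocycle_cob_of_locallyTrivial_aux`, by
strong induction on `[Γ_K : N]` where `N = Gal(K̄/L)` is an open normal subgroup on which `e` is a
coboundary — every class dies on such an `N`, `exists_intermediateField_isGalois_cob`):
* `[Γ_K : N] · [e] = 0` (`BrauerTower.index_smul_eq_zero_of_resH_eq_zero`, i.e. `Cor ∘ Res`), and the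
  primes of the order are peeled off one at a time (powers of cocycles, `twoCocycle_pow`), so it is
  enough to treat a `p`-primary class;
* **descent** (`hdescend`): for a proper subgroup `H < Gal(L/K)` with fixed field `E = L^H`, the
  base change of `e` to `Γ_E` (`twoCocycle_baseChange`; it dies on `res⁻¹(N)`, of index
  `[Gal(K̄/E) : N] < [Γ_K : N]`, and is locally trivial at the places of `E`,
  `BrauerCocycleTransfer`) is a coboundary by induction, hence `e` is a coboundary on
  `res(Γ_E) = τ Gal(K̄/E) τ⁻¹` (`exists_cob_range_of_exists_cob`,
  `exists_range_absGaloisRestrict_eq_map_conj`) and so on `Gal(K̄/E)` (`exists_cob_of_exists_cob_conj`);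
* **`p`-primary classes** (`hclaim`): let `P` be a Sylow `p`-subgroup of `Gal(L/K)`.  If
  `P = Gal(L/K) ≠ 1`, a `p`-group has a normal subgroup `T` with non-trivial cyclic quotient
  (`exists_normal_isCyclic_quotient_of_isPGroup`); the corresponding cyclic layer
  `χ : Γ_K → Gal(L/K)/T ≅ ℤ/d` (`exists_cyclicCharacter_ker_eq`) has kernel `Gal(K̄/L^T)`, on which
  `e` dies by descent, and the **cyclic step** `twoCocycle_cob_of_cyclicLayer` (Hasse's norm
  theorem, `BrauerCyclicLayer`) shows that `e` is a coboundary.  If `P ≠ Gal(L/K)`, `e` dies on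
  `Gal(K̄/L^P)` by descent, an open subgroup of index `[G : P]` prime to `p`, so the `p`-primary class
  `[e]` vanishes (`BrauerTower.eq_zero_of_resH_eq_zero_of_psmul_eq_zero`).

Also: `exists_normal_isCyclic_quotient_of_isPGroup` (group theory), `twoCocycle_baseChange`,
`exists_cob_comap_of_exists_cob`, `exists_range_absGaloisRestrict_eq_map_conj` (the image of
`Γ_E → Γ_K` is a conjugate of `Gal(K̄/E)`), `exists_cob_of_eq`, `exists_cob_pow_map`.

## References

* J. W. S. Cassels, A. Fröhlich (eds.), *Algebraic Number Theory* (1967), Ch. VII (J. Tate),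
  §9.6 (Hasse principle for cyclic layers from the norm theorem), §10 (reduction to cyclic
  extensions), §11.2. [CasselsFrohlichANT1967]
* J.-P. Serre, *Corps locaux* / *Local Fields* (1979), VII §5, IX §2 (Sylow restriction), X §7,
  XIII §3–4. [SerreLocalFields1979]
* J.-P. Serre, *Cohomologie galoisienne* (1997), I §2.2–2.4. [SerreGaloisCohomology1997]
* J. Neukirch, A. Schmidt, K. Wingberg, *Cohomology of Number Fields* (2008), (8.1.17).
  [NeukirchSchmidtWingberg2008]
* J. S. Milne, *Fields and Galois Theory* (2022), Ch. 7. [MilneFT2022]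
-/

noncomputable section

open CategoryTheory Topology NumberField IsDedekindDomain IntermediateField

universe u

namespace Literature.NumberTheory.GaloisRepresentations

open _root_.TopRep _root_.ContRepresentation _root_.ContinuousCohomology DiscreteGaloisModule Field
  LocalWeilDatum

/-! ### Group theory: a non-trivial finite `p`-group has a non-trivial cyclic quotient -/

section PGroup

/-- **A non-trivial finite `p`-group has a proper normal subgroup with cyclic quotient** (induction
on the order: a cyclic group has the trivial subgroup; otherwise divide by a proper non-trivial
normal subgroup — the centre, or a cyclic subgroup if the group is abelian — and pull back).
[folklore] -/
theorem exists_normal_isCyclic_quotient_of_isPGroup {p : ℕ} [hp : Fact p.Prime] :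
    ∀ (n : ℕ) (G : Type u) [Group G] [Finite G], Nat.card G = n → IsPGroup p G → Nontrivial G →
      ∃ (T : Subgroup G) (_ : T.Normal), T ≠ ⊤ ∧ IsCyclic (G ⧸ T) := by
  intro n
  induction n using Nat.strong_induction_on with
  | _ n ih =>
  intro G _ _ hn hG hnt
  classical
  by_cases hcyc : IsCyclic G
  · refine ⟨⊥, inferInstance, bot_ne_top, ?_⟩
    haveI := hcyc
    exact isCyclic_of_surjective (QuotientGroup.mk' (⊥ : Subgroup G)) (QuotientGroup.mk'_surjective _)
  -- a proper non-trivial normal subgroup `N`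
  obtain ⟨N, hNnormal, hNbot, hNtop⟩ : ∃ N : Subgroup G, N.Normal ∧ N ≠ ⊥ ∧ N ≠ ⊤ := by
    by_cases hZ : Subgroup.center G = ⊤
    · -- abelian, not cyclic: a cyclic subgroup generated by `g ≠ 1`
      obtain ⟨g, hg⟩ := exists_ne (1 : G)
      have hcomm : ∀ a b : G, a * b = b * a := fun a b => by
        have ha : a ∈ Subgroup.center G := by rw [hZ]; exact Subgroup.mem_top a
        exact (Subgroup.mem_center_iff.mp ha b).symm
      refine ⟨Subgroup.zpowers g, ?_, ?_, ?_⟩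
      · exact ⟨fun x hx y => by rwa [hcomm y x, mul_inv_cancel_right]⟩
      · rw [Ne, Subgroup.zpowers_eq_bot]; exact hg
      · intro htop
        exact hcyc (isCyclic_iff_exists_zpowers_eq_top.mpr ⟨g, htop⟩)
    · haveI := hG.center_nontrivial
      exact ⟨Subgroup.center G, inferInstance, (Subgroup.center G).nontrivial_iff_ne_bot.mp inferInstance, hZ⟩
  haveI := hNnormal
  -- induction on `G ⧸ N`
  have hlt : Nat.card (G ⧸ N) < n := by
    rw [← hn, ← N.index_eq_card]
    have h1 := N.index_mul_card
    have h2 : 1 < Nat.card N := (Subgroup.one_lt_card_iff_ne_bot N).mpr hNbot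
    have h3 : 0 < N.index := Nat.pos_of_ne_zero Subgroup.index_ne_zero_of_finite
    nlinarith
  haveI : Nontrivial (G ⧸ N) := (QuotientGroup.nontrivial_iff (N := N)).mpr hNtop
  obtain ⟨T', hT'normal, hT'top, hT'cyc⟩ := ih _ hlt (G ⧸ N) rfl (hG.to_quotient N) inferInstance
  haveI := hT'normal
  refine ⟨T'.comap (QuotientGroup.mk' N), inferInstance, ?_, ?_⟩
  · intro htop
    apply hT'top
    rw [← Subgroup.map_comap_eq_self_of_surjective (QuotientGroup.mk'_surjective N) T', htop,
      Subgroup.map_top_of_surjective _ (QuotientGroup.mk'_surjective N)]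
  · have hle : N ≤ T'.comap (QuotientGroup.mk' N) := by
      intro x hx
      rw [Subgroup.mem_comap, QuotientGroup.mk'_apply, (QuotientGroup.eq_one_iff x).mpr hx]
      exact one_mem _
    have hmap : (T'.comap (QuotientGroup.mk' N)).map (QuotientGroup.mk' N) = T' :=
      Subgroup.map_comap_eq_self_of_surjective (QuotientGroup.mk'_surjective N) T'
    haveI : ((T'.comap (QuotientGroup.mk' N)).map (QuotientGroup.mk' N)).Normal := by rw [hmap]; infer_instance
    haveI := hT'cyc
    let e := QuotientGroup.quotientQuotientEquivQuotient N (T'.comap (QuotientGroup.mk' N)) hle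
    let e' := QuotientGroup.quotientMulEquivOfEq hmap
    exact isCyclic_of_surjective (e.toMonoidHom.comp e'.symm.toMonoidHom)
      (e.surjective.comp e'.symm.surjective)

end PGroup

/-! ### Base change of explicit cocycles -/

section BaseChange

variable (F : Type u) [Field F] (L : Type u) [Field L] [Algebra F L]

/-- **The base change `ι ∘ e ∘ (res × res)` of a locally constant `2`-cocycle is one.** [folklore] -/
theorem twoCocycle_baseChange
    (e : absoluteGaloisGroup F → absoluteGaloisGroup F → (AlgebraicClosure F)ˣ)
    (hlc : IsLocallyConstant fun p : absoluteGaloisGroup F × absoluteGaloisGroup F => e p.1 p.2)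
    (hcoc : ∀ σ τ υ, e σ τ * e (σ * τ) υ = σ • e τ υ * e σ (τ * υ)) :
    IsLocallyConstant (fun p : absoluteGaloisGroup L × absoluteGaloisGroup L =>
      Units.map (absClosureEmbedding F L : AlgebraicClosure F →* AlgebraicClosure L)
        (e (absGaloisRestrict F L p.1) (absGaloisRestrict F L p.2))) ∧
    ∀ x y w : absoluteGaloisGroup L,
      Units.map (absClosureEmbedding F L : AlgebraicClosure F →* AlgebraicClosure L)
          (e (absGaloisRestrict F L x) (absGaloisRestrict F L y)) *
        Units.map (absClosureEmbedding F L : AlgebraicClosure F →* AlgebraicClosure L)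
          (e (absGaloisRestrict F L (x * y)) (absGaloisRestrict F L w)) =
      x • Units.map (absClosureEmbedding F L : AlgebraicClosure F →* AlgebraicClosure L)
          (e (absGaloisRestrict F L y) (absGaloisRestrict F L w)) *
        Units.map (absClosureEmbedding F L : AlgebraicClosure F →* AlgebraicClosure L)
          (e (absGaloisRestrict F L x) (absGaloisRestrict F L (y * w))) := by
  constructor
  · exact (hlc.comp_continuous (f := fun p : absoluteGaloisGroup L × absoluteGaloisGroup L =>
      (absGaloisRestrict F L p.1, absGaloisRestrict F L p.2)) (by fun_prop)).comp _
  intro x y w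
  have hcompat : ∀ (X : absoluteGaloisGroup L) (u : (AlgebraicClosure F)ˣ),
      Units.map (absClosureEmbedding F L : AlgebraicClosure F →* AlgebraicClosure L) (absGaloisRestrict F L X • u) =
        X • Units.map (absClosureEmbedding F L : AlgebraicClosure F →* AlgebraicClosure L) u := by
    intro X u; ext
    change absClosureEmbedding F L ((absGaloisRestrict F L X • u : (AlgebraicClosure F)ˣ) : AlgebraicClosure F) =
      X • absClosureEmbedding F L (u : AlgebraicClosure F)
    rw [Units.coe_smul, absGaloisRestrict_apply_smul]
  rw [← map_mul, map_mul (absGaloisRestrict F L), hcoc, map_mul, hcompat, ← map_mul (absGaloisRestrict F L)]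

/-- **A coboundary on `N ≤ Γ_F` base-changes to a coboundary on `res⁻¹(N) ≤ Γ_L`.** [folklore] -/
theorem exists_cob_comap_of_exists_cob (N : Subgroup (absoluteGaloisGroup F))
    (e : absoluteGaloisGroup F → absoluteGaloisGroup F → (AlgebraicClosure F)ˣ)
    (h : ∃ b : N → (AlgebraicClosure F)ˣ, IsLocallyConstant b ∧
      ∀ x y : N, e x y = b x * (x : absoluteGaloisGroup F) • b y / b (x * y)) :
    ∃ b : (N.comap ((absGaloisRestrict F L : absoluteGaloisGroup L →ₜ* absoluteGaloisGroup F) :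
        absoluteGaloisGroup L →* absoluteGaloisGroup F)) → (AlgebraicClosure L)ˣ, IsLocallyConstant b ∧
      ∀ x y : (N.comap ((absGaloisRestrict F L : absoluteGaloisGroup L →ₜ* absoluteGaloisGroup F) :
        absoluteGaloisGroup L →* absoluteGaloisGroup F)),
        Units.map (absClosureEmbedding F L : AlgebraicClosure F →* AlgebraicClosure L)
          (e (absGaloisRestrict F L x) (absGaloisRestrict F L y)) =
        b x * (x : absoluteGaloisGroup L) • b y / b (x * y) := by
  obtain ⟨b, hb, hbe⟩ := h
  let r : (N.comap ((absGaloisRestrict F L : absoluteGaloisGroup L →ₜ* absoluteGaloisGroup F) :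
      absoluteGaloisGroup L →* absoluteGaloisGroup F)) → N := fun x => ⟨absGaloisRestrict F L x, x.2⟩
  have hr : Continuous r := Continuous.subtype_mk ((absGaloisRestrict F L).continuous.comp continuous_subtype_val) _
  have hrmul : ∀ x y, r (x * y) = r x * r y := fun x y => Subtype.ext (map_mul (absGaloisRestrict F L) _ _)
  refine ⟨fun x => Units.map (absClosureEmbedding F L : AlgebraicClosure F →* AlgebraicClosure L) (b (r x)),
    (hb.comp_continuous hr).comp _, fun x y => ?_⟩
  have key := hbe (r x) (r y)
  rw [← hrmul] at key
  change e (absGaloisRestrict F L x) (absGaloisRestrict F L y) = _ at key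
  rw [key, map_div, map_mul]
  congr 2
  ext
  change absClosureEmbedding F L ((absGaloisRestrict F L x • b (r y) : (AlgebraicClosure F)ˣ) : AlgebraicClosure F) =
    (x : absoluteGaloisGroup L) • absClosureEmbedding F L (b (r y) : AlgebraicClosure F)
  rw [Units.coe_smul, absGaloisRestrict_apply_smul]

/-- **The image of `Γ_{E} → Γ_F` for a finite subextension `E ⊆ F̄` is a conjugate of
`Gal(F̄/E)`**: `res(Γ_E) = τ Gal(F̄/E) τ⁻¹` where `τ ∈ Γ_F` carries the inclusion `E ⊆ F̄` to the
embedding `ι⁻¹ ∘ (E → Ē)` underlying the chosen `ι : F̄ → Ē` (Milne FT §7: the restriction is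
well defined up to conjugacy). [cite: MilneFT2022, Ch. 7] -/
theorem exists_range_absGaloisRestrict_eq_map_conj [CharZero F]
    (E : IntermediateField F (AlgebraicClosure F)) [FiniteDimensional F E] :
    ∃ τ : absoluteGaloisGroup F,
      ((absGaloisRestrict F E : absoluteGaloisGroup E →ₜ* absoluteGaloisGroup F) :
          absoluteGaloisGroup E →* absoluteGaloisGroup F).range =
        (galFixing F E).map (MulAut.conj τ).toMonoidHom := by
  classical
  haveI : Algebra.IsAlgebraic F E := Algebra.IsAlgebraic.of_finite F E
  -- the two `F`-embeddings `E → F̄`: the inclusion, and `j' = ι⁻¹ ∘ (E → Ē)`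
  let ιE : AlgebraicClosure F ≃ₐ[F] AlgebraicClosure E := absClosureEquiv F E
  let j' : E →ₐ[F] AlgebraicClosure F :=
    (ιE.symm : AlgebraicClosure E →ₐ[F] AlgebraicClosure F).comp (IsScalarTower.toAlgHom F E (AlgebraicClosure E))
  have hj' : ∀ x : E, ιE (j' x) = algebraMap E (AlgebraicClosure E) x := fun x => by
    change ιE (ιE.symm _) = _
    rw [AlgEquiv.apply_symm_apply]
    rfl
  -- extend `j'` to `τ ∈ Γ_F`: `τ (x : F̄) = j' x`
  let τh : AlgebraicClosure F →ₐ[F] AlgebraicClosure F := j'.liftNormal (AlgebraicClosure F)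
  have hτh : ∀ x : E, τh (x : AlgebraicClosure F) = j' x := fun x => by
    have h := j'.liftNormal_commutes (AlgebraicClosure F) x
    exact h
  let τ : absoluteGaloisGroup F := (absoluteGaloisGroup.toAlgEquiv F).symm
    (AlgEquiv.ofBijective τh (Algebra.IsAlgebraic.algHom_bijective τh))
  have hτ : ∀ x : E, τ • (x : AlgebraicClosure F) = j' x := fun x => hτh x
  refine ⟨τ, Subgroup.ext fun g => ?_⟩
  rw [MonoidHom.mem_range, Subgroup.mem_map]
  constructor
  · rintro ⟨σ, rfl⟩
    refine ⟨τ⁻¹ * absGaloisRestrict F E σ * τ, ?_, by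
      change τ * (τ⁻¹ * absGaloisRestrict F E σ * τ) * τ⁻¹ = absGaloisRestrict F E σ; group⟩
    rw [mem_galFixing_iff]
    intro x hx
    rw [mul_smul, mul_smul, inv_smul_eq_iff, hτ ⟨x, hx⟩]
    apply ιE.injective
    change absClosureEmbedding F E (absGaloisRestrict F E σ • j' ⟨x, hx⟩) = ιE (j' ⟨x, hx⟩)
    rw [absGaloisRestrict_apply_smul]
    change σ • ιE (j' ⟨x, hx⟩) = ιE (j' ⟨x, hx⟩)
    rw [hj']
    exact σ.commutes _
  · rintro ⟨s, hs, rfl⟩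
    rw [mem_galFixing_iff] at hs
    -- `g = τ s τ⁻¹` fixes `j'(E)`; conjugate by `ι` to an automorphism of `Ē` over `E`
    set g : absoluteGaloisGroup F := τ * s * τ⁻¹ with hgdef
    have hg : ∀ x : E, g • j' x = j' x := fun x => by
      rw [hgdef, mul_smul, mul_smul, ← hτ, inv_smul_smul, hs _ x.2, hτ]
    let gA : AlgebraicClosure F ≃ₐ[F] AlgebraicClosure F := absoluteGaloisGroup.toAlgEquiv F g
    let σ₀ : AlgebraicClosure E ≃ₐ[F] AlgebraicClosure E := (ιE.symm.trans gA).trans ιE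
    have hσ₀ : ∀ x : E, σ₀ (algebraMap E (AlgebraicClosure E) x) = algebraMap E (AlgebraicClosure E) x := by
      intro x
      change ιE (gA (ιE.symm (algebraMap E (AlgebraicClosure E) x))) = _
      rw [← hj', AlgEquiv.symm_apply_apply]
      change ιE (g • j' x) = _
      rw [hg, hj']
    let σ : absoluteGaloisGroup E := (absoluteGaloisGroup.toAlgEquiv E).symm
      { σ₀.toRingEquiv with commutes' := hσ₀ }
    refine ⟨σ, ?_⟩
    have hcoe : ((absGaloisRestrict F E : absoluteGaloisGroup E →ₜ* absoluteGaloisGroup F) :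
        absoluteGaloisGroup E →* absoluteGaloisGroup F) σ = absGaloisRestrict F E σ := rfl
    rw [hcoe]
    apply FaithfulSMul.eq_of_smul_eq_smul (α := AlgebraicClosure F)
    intro m
    apply (absClosureEmbedding F E).toRingHom.injective
    change absClosureEmbedding F E (absGaloisRestrict F E σ • m) = ιE (g • m)
    rw [absGaloisRestrict_apply_smul]
    change ιE (gA (ιE.symm (ιE m))) = ιE (gA m)
    rw [AlgEquiv.symm_apply_apply]

end BaseChange

/-! ### Transport of coboundaries along an equality of subgroups; powers under a map -/

section Helpers

variable {F : Type u} [Field F]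

/-- Coboundaries on equal subgroups. [folklore] -/
theorem exists_cob_of_eq {S₁ S₂ : Subgroup (absoluteGaloisGroup F)} (h : S₁ = S₂)
    (e : absoluteGaloisGroup F → absoluteGaloisGroup F → (AlgebraicClosure F)ˣ)
    (hk : ∃ b : S₁ → (AlgebraicClosure F)ˣ, IsLocallyConstant b ∧
      ∀ x y : S₁, e x y = b x * (x : absoluteGaloisGroup F) • b y / b (x * y)) :
    ∃ b : S₂ → (AlgebraicClosure F)ˣ, IsLocallyConstant b ∧
      ∀ x y : S₂, e x y = b x * (x : absoluteGaloisGroup F) • b y / b (x * y) := by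
  subst h
  exact hk

/-- Powers of a cocycle which is a coboundary after a multiplicative map are coboundaries after
the map. [folklore] -/
theorem exists_cob_pow_map {H : Type*} [Group H] [TopologicalSpace H] {B : Type*} [CommGroup B]
    [MulDistribMulAction H B] (E : H → H → (AlgebraicClosure F)ˣ) (ι : (AlgebraicClosure F)ˣ →* B)
    (k : ℕ) (h : ∃ b : H → B, IsLocallyConstant b ∧ ∀ x y, ι (E x y) = b x * x • b y / b (x * y)) :
    ∃ b : H → B, IsLocallyConstant b ∧ ∀ x y, ι (E x y ^ k) = b x * x • b y / b (x * y) := by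
  obtain ⟨b, hb, hbe⟩ := h
  exact ⟨fun x => b x ^ k, hb.comp fun u => u ^ k, fun x y => by
    rw [map_pow, hbe, div_pow, mul_pow, smul_pow']⟩

end Helpers

/-! ### Cyclic characters from cyclic quotients of finite Galois groups -/

section Character

variable {K : Type u} [Field K]

/-- **A normal subgroup `T ⊴ Gal(L/K)` with cyclic quotient defines a cyclic layer of `Γ_K`**:
`χ = (Γ_K → Gal(L/K) → Gal(L/K)/T ≃ ℤ/d)`, continuous since it is constant on the cosets of the
open subgroup `Gal(K̄/L)`, surjective, with kernel `Gal(K̄/L^T)` (`galFixing_lift_fixedField`).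
[cite: NeukirchANT1999, Ch. IV §1] -/
theorem exists_cyclicCharacter_ker_eq (L : IntermediateField K (AlgebraicClosure K))
    [FiniteDimensional K L] [IsGalois K L] (T : Subgroup (L ≃ₐ[K] L)) [T.Normal]
    [hcyc : IsCyclic ((L ≃ₐ[K] L) ⧸ T)] :
    ∃ χ : CyclicCharacter (absoluteGaloisGroup K) (Nat.card ((L ≃ₐ[K] L) ⧸ T)),
      χ.ker = galFixing K (lift (fixedField T)) := by
  classical
  let ε := zmodCyclicMulEquiv hcyc
  let φ : absoluteGaloisGroup K →* Multiplicative (ZMod (Nat.card ((L ≃ₐ[K] L) ⧸ T))) :=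
    ε.symm.toMonoidHom.comp ((QuotientGroup.mk' T).comp (resGal L))
  have hφ : ∀ σ, φ σ = ε.symm (QuotientGroup.mk' T (resGal L σ)) := fun σ => rfl
  have hφker : ∀ σ, φ σ = 1 ↔ resGal L σ ∈ T := fun σ => by
    rw [hφ, MulEquiv.map_eq_one_iff, QuotientGroup.mk'_apply, QuotientGroup.eq_one_iff]
  have hφsurj : Function.Surjective φ :=
    ε.symm.surjective.comp ((QuotientGroup.mk'_surjective T).comp (resGal_surjective L))
  have hlc : IsLocallyConstant fun σ => Multiplicative.toAdd (φ σ) := by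
    refine (IsLocallyConstant.iff_exists_open _).mpr fun σ => ?_
    refine ⟨(fun x => σ⁻¹ * x) ⁻¹' (galFixing K L : Set (absoluteGaloisGroup K)),
      (isOpen_galFixing K L).preimage (by fun_prop), ?_, fun x hx => ?_⟩
    · change σ⁻¹ * σ ∈ galFixing K L
      rw [inv_mul_cancel]
      exact one_mem _
    · change σ⁻¹ * x ∈ galFixing K L at hx
      rw [← ker_resGal L, MonoidHom.mem_ker, map_mul, map_inv, inv_mul_eq_one] at hx
      rw [hφ, hφ, hx]
  refine ⟨{ toFun := fun σ => Multiplicative.toAdd (φ σ)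
            map_mul' := fun σ τ => by rw [map_mul]; rfl
            continuous_toFun := hlc.continuous
            surjective' := fun a => ?_ }, ?_⟩
  · obtain ⟨σ, hσ⟩ := hφsurj (Multiplicative.ofAdd a)
    exact ⟨σ, by change Multiplicative.toAdd (φ σ) = a; rw [hσ]; rfl⟩
  · ext σ
    rw [CyclicCharacter.mem_ker, galFixing_lift_fixedField L T, Subgroup.mem_comap, ← hφker]
    change Multiplicative.toAdd (φ σ) = 0 ↔ φ σ = 1
    exact toAdd_eq_zero

end Character

/-! ### The induction over number fields -/

section Main

/-- **The Hasse principle for `H²(K, K̄ˣ)`, inductive form.**  For every number field `K`, every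
locally constant `2`-cocycle `e : Γ_K × Γ_K → K̄ˣ` which is a coboundary on `Gal(K̄/L)` for a
finite Galois `L/K` with `[Γ_K : Gal(K̄/L)] ≤ n`, and which is locally a coboundary at every place
of `K`, is a coboundary.  Proof (Brauer–Hasse–Noether / Cassels–Fröhlich VII §9.6–§10, by
induction on `n`): `[L:K]·[e] = 0` (`Cor ∘ Res`); peel off the primes of the order one at a time;
for a `p`-primary class, if `Gal(L/K)` is a `p`-group it has a cyclic quotient layer `E₀/K` and the
cyclic step (`twoCocycle_cob_of_cyclicLayer`, i.e. Hasse's norm theorem) applies once `e` dies on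
`Gal(K̄/E₀)` — which is the induction hypothesis over the number field `E₀` (local triviality
passes to `E₀`, `exists_cob_adicCompletion_baseChange`); otherwise restrict to the fixed field
`K₁` of a Sylow `p`-subgroup (induction hypothesis over `K₁`) and use the injectivity of
restriction on `p`-primary classes for index prime to `p`.
[cite: CasselsFrohlichANT1967, Ch. VII §9.6, §10, §11.2; SerreLocalFields1979, X §7, XIII §3–4] -/
theorem twoCocycle_cob_of_locallyTrivial_aux (n : ℕ) :
    ∀ (K : Type u) [Field K] [NumberField K]
      (e : absoluteGaloisGroup K → absoluteGaloisGroup K → (AlgebraicClosure K)ˣ),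
      IsLocallyConstant (fun p : absoluteGaloisGroup K × absoluteGaloisGroup K => e p.1 p.2) →
      (∀ σ τ υ, e σ τ * e (σ * τ) υ = σ • e τ υ * e σ (τ * υ)) →
      (∃ L : IntermediateField K (AlgebraicClosure K), FiniteDimensional K L ∧ IsGalois K L ∧
        (galFixing K L).index ≤ n ∧
        ∃ b : galFixing K L → (AlgebraicClosure K)ˣ, IsLocallyConstant b ∧
          ∀ x y : galFixing K L, e x y = b x * (x : absoluteGaloisGroup K) • b y / b (x * y)) →
      (∀ v : HeightOneSpectrum (𝓞 K),
        ∃ b : absoluteGaloisGroup (v.adicCompletion K) → (AlgebraicClosure (v.adicCompletion K))ˣ,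
          IsLocallyConstant b ∧ ∀ x y,
            Units.map (absClosureEmbedding K (v.adicCompletion K) :
                AlgebraicClosure K →* AlgebraicClosure (v.adicCompletion K))
              (e (absGaloisRestrict K (v.adicCompletion K) x) (absGaloisRestrict K (v.adicCompletion K) y)) =
            b x * x • b y / b (x * y)) →
      (∀ w : InfinitePlace K,
        ∃ b : absoluteGaloisGroup w.Completion → (AlgebraicClosure w.Completion)ˣ,
          IsLocallyConstant b ∧ ∀ x y,
            Units.map (absClosureEmbedding K w.Completion : AlgebraicClosure K →* AlgebraicClosure w.Completion)
              (e (absGaloisRestrict K w.Completion x) (absGaloisRestrict K w.Completion y)) =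
            b x * x • b y / b (x * y)) →
      ∃ b : absoluteGaloisGroup K → (AlgebraicClosure K)ˣ, IsLocallyConstant b ∧
        ∀ σ τ, e σ τ = b σ * σ • b τ / b (σ * τ) := by
  induction n using Nat.strong_induction_on with
  | _ n ih =>
  intro K _ _ e hlc hcoc hL hfin hinf
  obtain ⟨L, hLfin, hLgal, hidx, hkill⟩ := hL
  classical
  haveI := hLfin
  haveI := hLgal
  -- notation-free abbreviations
  set N : Subgroup (absoluteGaloisGroup K) := galFixing K L with hNdef
  haveI hNnormal : N.Normal := normal_galFixing L
  have hNopen : IsOpen (N : Set (absoluteGaloisGroup K)) := isOpen_galFixing K L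
  haveI : CompactSpace N := isCompact_iff_compactSpace.mp (isClosed_galFixing K L).isCompact
  have hNbot : N = (⊥ : Subgroup (L ≃ₐ[K] L)).comap (resGal L) := by
    rw [MonoidHom.comap_bot, ker_resGal]
  have hNidx : N.index = Nat.card (L ≃ₐ[K] L) := by
    rw [hNbot, Subgroup.index_comap_of_surjective _ (resGal_surjective L), Subgroup.index_bot]
  have hNpos : 0 < N.index := by rw [hNidx]; exact Nat.card_pos
  /- **Descent**: for a proper subgroup `H < Gal(L/K)` with fixed field `E = L^H`, every cocycle
    `e'` over `K` dying on `N` and locally trivial dies on `Gal(K̄/E)` — by the induction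
    hypothesis over the number field `E`. -/
  have hdescend : ∀ (H : Subgroup (L ≃ₐ[K] L)), H ≠ ⊤ →
      ∀ (e' : absoluteGaloisGroup K → absoluteGaloisGroup K → (AlgebraicClosure K)ˣ),
        IsLocallyConstant (fun p : absoluteGaloisGroup K × absoluteGaloisGroup K => e' p.1 p.2) →
        (∀ σ τ υ, e' σ τ * e' (σ * τ) υ = σ • e' τ υ * e' σ (τ * υ)) →
        (∃ b : N → (AlgebraicClosure K)ˣ, IsLocallyConstant b ∧
          ∀ x y : N, e' x y = b x * (x : absoluteGaloisGroup K) • b y / b (x * y)) →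
        (∀ v : HeightOneSpectrum (𝓞 K),
          ∃ b : absoluteGaloisGroup (v.adicCompletion K) → (AlgebraicClosure (v.adicCompletion K))ˣ,
            IsLocallyConstant b ∧ ∀ x y,
              Units.map (absClosureEmbedding K (v.adicCompletion K) :
                  AlgebraicClosure K →* AlgebraicClosure (v.adicCompletion K))
                (e' (absGaloisRestrict K (v.adicCompletion K) x) (absGaloisRestrict K (v.adicCompletion K) y)) =
              b x * x • b y / b (x * y)) →
        (∀ w : InfinitePlace K,
          ∃ b : absoluteGaloisGroup w.Completion → (AlgebraicClosure w.Completion)ˣ,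
            IsLocallyConstant b ∧ ∀ x y,
              Units.map (absClosureEmbedding K w.Completion : AlgebraicClosure K →* AlgebraicClosure w.Completion)
                (e' (absGaloisRestrict K w.Completion x) (absGaloisRestrict K w.Completion y)) =
              b x * x • b y / b (x * y)) →
        ∃ b : galFixing K (lift (fixedField H)) → (AlgebraicClosure K)ˣ, IsLocallyConstant b ∧
          ∀ x y : galFixing K (lift (fixedField H)),
            e' x y = b x * (x : absoluteGaloisGroup K) • b y / b (x * y) := by
    intro H hH e' hlc' hcoc' hk' hfin' hinf'
    -- the number field `E = L^H`
    set E : IntermediateField K (AlgebraicClosure K) := lift (fixedField H) with hEdef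
    haveI : FiniteDimensional K E := (liftAlgEquiv (fixedField H)).toLinearEquiv.finiteDimensional
    haveI : CharZero E := charZero_of_injective_algebraMap (algebraMap K E).injective
    haveI : NumberField E :=
      { to_charZero := inferInstance
        to_finiteDimensional := Module.Finite.trans K E }
    haveI : Algebra.IsAlgebraic K E := Algebra.IsAlgebraic.of_finite K E
    have hSidx : (galFixing K E).index = H.index := index_galFixing_lift_fixedField L H
    have hNS : N ≤ galFixing K E := galFixing_le_galFixing_lift L (fixedField H)
    -- base change of `e'` to `Γ_E`
    obtain ⟨hlc'', hcoc''⟩ := twoCocycle_baseChange K E e' hlc' hcoc'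
    have hk'' := exists_cob_comap_of_exists_cob K E N e' hk'
    set N'' : Subgroup (absoluteGaloisGroup E) :=
      N.comap ((absGaloisRestrict K E : absoluteGaloisGroup E →ₜ* absoluteGaloisGroup K) :
        absoluteGaloisGroup E →* absoluteGaloisGroup K) with hN''def
    have hN''normal : N''.Normal := Subgroup.Normal.comap hNnormal _
    have hN''open : IsOpen (N'' : Set (absoluteGaloisGroup E)) :=
      hNopen.preimage (absGaloisRestrict K E).continuous
    obtain ⟨L'', hL''fin, hL''gal, hL''N⟩ :=
      exists_isGalois_fixingSubgroup_eq (F := E) (E := AlgebraicClosure E) N'' (hU := hN''normal) hN''open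
    have hgal'' : galFixing E L'' = N'' := by
      ext σ
      rw [← hL''N]
      rfl
    -- `[Γ_E : N''] = [Gal(K̄/E) : N] < [Γ_K : N] ≤ n`
    obtain ⟨τ, hτ⟩ := exists_range_absGaloisRestrict_eq_map_conj K E
    have hNconj : N.map (MulAut.conj τ).toMonoidHom = N := by
      ext x
      constructor
      · rintro ⟨y, hy, rfl⟩
        exact hNnormal.conj_mem y hy τ
      · intro hx
        refine ⟨τ⁻¹ * x * τ, ?_, ?_⟩
        · have := hNnormal.conj_mem x hx τ⁻¹
          rwa [inv_inv] at this
        · change τ * (τ⁻¹ * x * τ) * τ⁻¹ = x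
          group
    have hrel : N''.index = N.relIndex (galFixing K E) := by
      rw [hN''def, Subgroup.index_comap, hτ]
      conv_lhs => rw [← hNconj]
      exact Subgroup.relIndex_map_map_of_injective N (galFixing K E) (MulAut.conj τ).injective
    have hidx'' : N''.index < n := by
      rw [hrel]
      have hmul := Subgroup.relIndex_mul_index hNS
      have hH2 : 2 ≤ (galFixing K E).index := by
        rw [hSidx]
        have h0 : H.index ≠ 0 := Subgroup.index_ne_zero_of_finite
        have h1 : H.index ≠ 1 := fun h => hH (Subgroup.index_eq_one.mp h)
        omega
      have h2 : N.relIndex (galFixing K E) * 2 ≤ N.relIndex (galFixing K E) * (galFixing K E).index :=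
        Nat.mul_le_mul_left _ hH2
      rw [hmul] at h2
      omega
    -- the induction hypothesis over `E`
    have hcob'' := ih N''.index hidx'' E
      (fun x y => Units.map (absClosureEmbedding K E : AlgebraicClosure K →* AlgebraicClosure E)
        (e' (absGaloisRestrict K E x) (absGaloisRestrict K E y)))
      hlc'' hcoc''
      ⟨L'', hL''fin, hL''gal, le_of_eq (by rw [hgal'']), exists_cob_of_eq hgal''.symm
        (fun x y => Units.map (absClosureEmbedding K E : AlgebraicClosure K →* AlgebraicClosure E)
          (e' (absGaloisRestrict K E x) (absGaloisRestrict K E y))) hk''⟩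
      (fun w' => exists_cob_adicCompletion_baseChange e' hlc' hcoc' hfin' w')
      (fun w' => exists_cob_completion_baseChange e' hlc' hcoc' hinf' w')
    -- back over `K`: a coboundary on `res(Γ_E) = τ Gal(K̄/E) τ⁻¹`, hence on `Gal(K̄/E)`
    have hrange := exists_cob_range_of_exists_cob K E e' hcob''
    exact exists_cob_of_exists_cob_conj e' hlc' hcoc' (galFixing K E) τ (exists_cob_of_eq hτ e' hrange)
  /- **The `p`-primary case**: a cocycle over `K` dying on `N`, locally trivial, with `p^r`-torsion
    class, is a coboundary (Sylow `p`-subgroup `P` of `Gal(L/K)`: if `P = Gal(L/K)` use a cyclic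
    quotient layer and the cyclic step; otherwise restrict to `L^P`). -/
  have hclaim : ∀ (p r : ℕ), p.Prime →
      ∀ (e' : absoluteGaloisGroup K → absoluteGaloisGroup K → (AlgebraicClosure K)ˣ)
        (f' : contTwoCocycles (units K).toTopRep),
        IsLocallyConstant (fun q : absoluteGaloisGroup K × absoluteGaloisGroup K => e' q.1 q.2) →
        (∀ σ τ υ, e' σ τ * e' (σ * τ) υ = σ • e' τ υ * e' σ (τ * υ)) →
        (∃ b : N → (AlgebraicClosure K)ˣ, IsLocallyConstant b ∧
          ∀ x y : N, e' x y = b x * (x : absoluteGaloisGroup K) • b y / b (x * y)) →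
        (∀ v : HeightOneSpectrum (𝓞 K),
          ∃ b : absoluteGaloisGroup (v.adicCompletion K) → (AlgebraicClosure (v.adicCompletion K))ˣ,
            IsLocallyConstant b ∧ ∀ x y,
              Units.map (absClosureEmbedding K (v.adicCompletion K) :
                  AlgebraicClosure K →* AlgebraicClosure (v.adicCompletion K))
                (e' (absGaloisRestrict K (v.adicCompletion K) x) (absGaloisRestrict K (v.adicCompletion K) y)) =
              b x * x • b y / b (x * y)) →
        (∀ w : InfinitePlace K,
          ∃ b : absoluteGaloisGroup w.Completion → (AlgebraicClosure w.Completion)ˣ,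
            IsLocallyConstant b ∧ ∀ x y,
              Units.map (absClosureEmbedding K w.Completion : AlgebraicClosure K →* AlgebraicClosure w.Completion)
                (e' (absGaloisRestrict K w.Completion x) (absGaloisRestrict K w.Completion y)) =
              b x * x • b y / b (x * y)) →
        (∀ σ τ, f'.1 (σ, τ) = UnitsCarrier.ofUnits (e' σ τ)) →
        (p ^ r) • twoCocycleClass _ f' = 0 →
        ∃ b : absoluteGaloisGroup K → (AlgebraicClosure K)ˣ, IsLocallyConstant b ∧
          ∀ σ τ, e' σ τ = b σ * σ • b τ / b (σ * τ) := by
    intro p r hp e' f' hlc' hcoc' hk' hfin' hinf' hf' hpz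
    haveI : Fact p.Prime := ⟨hp⟩
    let P : Sylow p (L ≃ₐ[K] L) := default
    by_cases hPtop : (P : Subgroup (L ≃ₐ[K] L)) = ⊤
    · rcases subsingleton_or_nontrivial (L ≃ₐ[K] L) with hG | hG
      · -- `Gal(L/K) = 1`: `N = Γ_K`
        have hNtop : N = ⊤ := by
          rw [hNbot]
          exact eq_top_iff.2 fun σ _ => Subgroup.mem_comap.2 (Subgroup.mem_bot.2 (Subsingleton.elim _ _))
        obtain ⟨b, hb, hbe⟩ := hk'
        have hmem : ∀ σ : absoluteGaloisGroup K, σ ∈ N := fun σ => by rw [hNtop]; exact Subgroup.mem_top σ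
        exact ⟨fun σ => b ⟨σ, hmem σ⟩, hb.comp_continuous (Continuous.subtype_mk continuous_id _),
          fun σ τ => hbe ⟨σ, hmem σ⟩ ⟨τ, hmem τ⟩⟩
      · -- `Gal(L/K)` a non-trivial `p`-group: cyclic quotient layer
        have hPG : IsPGroup p (L ≃ₐ[K] L) := by
          have h1 : IsPGroup p (⊤ : Subgroup (L ≃ₐ[K] L)) := hPtop ▸ P.isPGroup'
          exact h1.of_equiv Subgroup.topEquiv
        obtain ⟨T, hTn, hTtop, hTcyc⟩ :=
          exists_normal_isCyclic_quotient_of_isPGroup (p := p) _ (L ≃ₐ[K] L) rfl hPG hG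
        haveI := hTn
        haveI := hTcyc
        obtain ⟨χ, hker⟩ := exists_cyclicCharacter_ker_eq L T
        haveI : FiniteDimensional K (lift (fixedField T) : IntermediateField K (AlgebraicClosure K)) :=
          (liftAlgEquiv (fixedField T)).toLinearEquiv.finiteDimensional
        haveI : IsGalois K (lift (fixedField T) : IntermediateField K (AlgebraicClosure K)) :=
          IsGalois.of_algEquiv (liftAlgEquiv (fixedField T))
        haveI : NeZero (Nat.card ((L ≃ₐ[K] L) ⧸ T)) := ⟨Nat.card_pos.ne'⟩
        have hd : 1 < Nat.card ((L ≃ₐ[K] L) ⧸ T) := by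
          change 1 < T.index
          have h0 : T.index ≠ 0 := Subgroup.index_ne_zero_of_finite
          have h1 : T.index ≠ 1 := fun h => hTtop (Subgroup.index_eq_one.mp h)
          omega
        exact twoCocycle_cob_of_cyclicLayer e' hlc' hcoc' hd χ (lift (fixedField T)) hker
          (hdescend T hTtop e' hlc' hcoc' hk' hfin' hinf') hfin' hinf'
    · -- `P ≠ Gal(L/K)`: restrict to `K₁ = L^P`, of index prime to `p`
      set E₁ : IntermediateField K (AlgebraicClosure K) := lift (fixedField (P : Subgroup (L ≃ₐ[K] L)))
        with hE₁def
      haveI : FiniteDimensional K E₁ :=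
        (liftAlgEquiv (fixedField (P : Subgroup (L ≃ₐ[K] L)))).toLinearEquiv.finiteDimensional
      have hkS := hdescend (P : Subgroup (L ≃ₐ[K] L)) hPtop e' hlc' hcoc' hk' hfin' hinf'
      have hSopen : IsOpen (galFixing K E₁ : Set (absoluteGaloisGroup K)) := isOpen_galFixing K E₁
      haveI : CompactSpace (galFixing K E₁) :=
        isCompact_iff_compactSpace.mp (isClosed_galFixing K E₁).isCompact
      have hres : resH (galFixing K E₁) (units K) 2 (twoCocycleClass _ f') = 0 :=
        (resH_twoCocycleClass_eq_zero_iff_exists_mul (galFixing K E₁) e' f' hf').mpr hkS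
      have hcop : (galFixing K E₁).index.Coprime p := by
        rw [hE₁def, index_galFixing_lift_fixedField L (P : Subgroup (L ≃ₐ[K] L))]
        exact ((Nat.Prime.coprime_iff_not_dvd hp).mpr P.not_dvd_index).symm
      have hz : twoCocycleClass _ f' = 0 :=
        eq_zero_of_resH_eq_zero_of_psmul_eq_zero (units K) (galFixing K E₁) hSopen hcop _ hres hpz
      exact (twoCocycleClass_eq_zero_iff_exists_mul e' f' hf').mp hz
  /- **Peeling off the primes of the order of the class.** -/
  have hm : ∀ m : ℕ, 0 < m →
      ∀ (e' : absoluteGaloisGroup K → absoluteGaloisGroup K → (AlgebraicClosure K)ˣ)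
        (f' : contTwoCocycles (units K).toTopRep),
        IsLocallyConstant (fun q : absoluteGaloisGroup K × absoluteGaloisGroup K => e' q.1 q.2) →
        (∀ σ τ υ, e' σ τ * e' (σ * τ) υ = σ • e' τ υ * e' σ (τ * υ)) →
        (∃ b : N → (AlgebraicClosure K)ˣ, IsLocallyConstant b ∧
          ∀ x y : N, e' x y = b x * (x : absoluteGaloisGroup K) • b y / b (x * y)) →
        (∀ v : HeightOneSpectrum (𝓞 K),
          ∃ b : absoluteGaloisGroup (v.adicCompletion K) → (AlgebraicClosure (v.adicCompletion K))ˣ,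
            IsLocallyConstant b ∧ ∀ x y,
              Units.map (absClosureEmbedding K (v.adicCompletion K) :
                  AlgebraicClosure K →* AlgebraicClosure (v.adicCompletion K))
                (e' (absGaloisRestrict K (v.adicCompletion K) x) (absGaloisRestrict K (v.adicCompletion K) y)) =
              b x * x • b y / b (x * y)) →
        (∀ w : InfinitePlace K,
          ∃ b : absoluteGaloisGroup w.Completion → (AlgebraicClosure w.Completion)ˣ,
            IsLocallyConstant b ∧ ∀ x y,
              Units.map (absClosureEmbedding K w.Completion : AlgebraicClosure K →* AlgebraicClosure w.Completion)
                (e' (absGaloisRestrict K w.Completion x) (absGaloisRestrict K w.Completion y)) =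
              b x * x • b y / b (x * y)) →
        (∀ σ τ, f'.1 (σ, τ) = UnitsCarrier.ofUnits (e' σ τ)) →
        m • twoCocycleClass _ f' = 0 →
        ∃ b : absoluteGaloisGroup K → (AlgebraicClosure K)ˣ, IsLocallyConstant b ∧
          ∀ σ τ, e' σ τ = b σ * σ • b τ / b (σ * τ) := by
    intro m
    induction m using Nat.strong_induction_on with
    | _ m ihm =>
    intro hm0 e' f' hlc' hcoc' hk' hfin' hinf' hf' hmz
    by_cases hm1 : m = 1
    · subst hm1
      rw [one_smul] at hmz
      exact (twoCocycleClass_eq_zero_iff_exists_mul e' f' hf').mp hmz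
    set p := m.minFac with hpdef
    have hp : p.Prime := Nat.minFac_prime hm1
    obtain ⟨r, m', hm'ndvd, hmeq⟩ := Nat.exists_eq_pow_mul_and_not_dvd hm0.ne' p hp.ne_one
    have hm'0 : 0 < m' := Nat.pos_of_ne_zero fun h => by
      rw [h, mul_zero] at hmeq
      omega
    have hle : m' ≤ m := by
      rw [hmeq]
      exact Nat.le_mul_of_pos_left m' (pow_pos hp.pos r)
    have hne : m' ≠ m := fun h => hm'ndvd (by rw [h]; exact Nat.minFac_dvd m)
    have hlt : m' < m := lt_of_le_of_ne hle hne
    -- the `m'`-th power of `e'` has `p^r`-torsion class, hence is a coboundary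
    obtain ⟨hlc'', hcoc''⟩ := twoCocycle_pow e' hlc' hcoc' m'
    have hf'' := exists_contTwoCocycles_pow_eq e' f' hf' m'
    have hpz : (p ^ r) • twoCocycleClass _ (((m' : ℕ) : ℤ) • f') = 0 := by
      rw [twoCocycleClass_natCast_smul, ← mul_nsmul', ← hmeq]
      exact hmz
    have hcob'' := hclaim p r hp (fun σ τ => e' σ τ ^ m') _ hlc'' hcoc''
      (exists_cob_pow N e' m' hk')
      (fun v => exists_cob_pow_map
        (fun x y => e' (absGaloisRestrict K (v.adicCompletion K) x) (absGaloisRestrict K (v.adicCompletion K) y))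
        (Units.map (absClosureEmbedding K (v.adicCompletion K) :
          AlgebraicClosure K →* AlgebraicClosure (v.adicCompletion K))) m' (hfin' v))
      (fun w => exists_cob_pow_map
        (fun x y => e' (absGaloisRestrict K w.Completion x) (absGaloisRestrict K w.Completion y))
        (Units.map (absClosureEmbedding K w.Completion : AlgebraicClosure K →* AlgebraicClosure w.Completion))
        m' (hinf' w))
      hf'' hpz
    have hz' : m' • twoCocycleClass _ f' = 0 := by
      rw [← twoCocycleClass_natCast_smul]
      exact (twoCocycleClass_eq_zero_iff_exists_mul _ _ hf'').mpr hcob''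
    exact ihm m' hlt hm'0 e' f' hlc' hcoc' hk' hfin' hinf' hf' hz'
  -- conclusion: `[Γ_K : N] · [e] = 0`
  obtain ⟨f, hf⟩ := exists_contTwoCocycles_eq e hlc hcoc
  have hres : resH N (units K) 2 (twoCocycleClass _ f) = 0 :=
    (resH_twoCocycleClass_eq_zero_iff_exists_mul N e f hf).mpr hkill
  have hNz : N.index • twoCocycleClass _ f = 0 :=
    index_smul_eq_zero_of_resH_eq_zero (units K) N hNopen _ hres
  exact hm N.index hNpos e f hlc hcoc hkill hfin hinf hf hNz

/-- **The Hasse principle for `H²(K, K̄ˣ)` (Albert–Brauer–Hasse–Noether), cocycle form.**  A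
locally constant `2`-cocycle `e : Γ_K × Γ_K → K̄ˣ` over a number field `K` which becomes a
coboundary over every completion `K_v` (finite `v`) and `K_w` (infinite `w`) is a coboundary:
`Br(K) → ⊕_v Br(K_v)` is injective.  Every class dies on some `Gal(K̄/L)`, `L/K` finite Galois
(`exists_intermediateField_isGalois_cob`), and `twoCocycle_cob_of_locallyTrivial_aux` applies.
[cite: CasselsFrohlichANT1967, Ch. VII §9.6 and §10 (Brauer–Hasse–Noether); SerreLocalFields1979, XIII §3, XIV] -/
theorem twoCocycle_cob_of_locallyTrivial {K : Type u} [Field K] [NumberField K]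
    (e : absoluteGaloisGroup K → absoluteGaloisGroup K → (AlgebraicClosure K)ˣ)
    (hlc : IsLocallyConstant fun p : absoluteGaloisGroup K × absoluteGaloisGroup K => e p.1 p.2)
    (hcoc : ∀ σ τ υ, e σ τ * e (σ * τ) υ = σ • e τ υ * e σ (τ * υ))
    (hfin : ∀ v : HeightOneSpectrum (𝓞 K),
      ∃ b : absoluteGaloisGroup (v.adicCompletion K) → (AlgebraicClosure (v.adicCompletion K))ˣ,
        IsLocallyConstant b ∧ ∀ x y,
          Units.map (absClosureEmbedding K (v.adicCompletion K) :
              AlgebraicClosure K →* AlgebraicClosure (v.adicCompletion K))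
            (e (absGaloisRestrict K (v.adicCompletion K) x) (absGaloisRestrict K (v.adicCompletion K) y)) =
          b x * x • b y / b (x * y))
    (hinf : ∀ w : InfinitePlace K,
      ∃ b : absoluteGaloisGroup w.Completion → (AlgebraicClosure w.Completion)ˣ,
        IsLocallyConstant b ∧ ∀ x y,
          Units.map (absClosureEmbedding K w.Completion : AlgebraicClosure K →* AlgebraicClosure w.Completion)
            (e (absGaloisRestrict K w.Completion x) (absGaloisRestrict K w.Completion y)) =
          b x * x • b y / b (x * y)) :
    ∃ b : absoluteGaloisGroup K → (AlgebraicClosure K)ˣ, IsLocallyConstant b ∧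
      ∀ σ τ, e σ τ = b σ * σ • b τ / b (σ * τ) := by
  obtain ⟨L, hLfin, hLgal, hk⟩ := exists_intermediateField_isGalois_cob K e hlc
  exact twoCocycle_cob_of_locallyTrivial_aux _ K e hlc hcoc ⟨L, hLfin, hLgal, le_rfl, hk⟩ hfin hinf

end Main

end Literature.NumberTheory.GaloisRepresentations
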